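import Summits.Langlands.Langlands.Theses.SteinbergWeightVelocity

/-!
# Disproof of `NonSplitSteinbergPieces` (crux `stmt-Langlands-13451`, route SteinbergWeightVelocity) — findings

Standing disprover's work file (cdisprove; cycle 2 = gen-2 reconstruction: the cycle-1 file lives only
in the gate evidence store `run/gate/evidence/stmt-Langlands-13451/20260815T225008Z-Disproof.lean`,
which is not readable from hub seats, so its CHECKED content is rebuilt here from the item notes).

VERDICT (unchanged from cycle 1): **refuted-misstated ON PAPER, `¬S` NOT landable in Lean.**

* §1 `Relabelling`, `precomp`, `isKPX_precomp`: every `PhiGammaModuleRobba` datum `𝓣` and every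
  class-bijective relabelling `σ` of framed Galois representations fixing the class of `1` give a new
  datum `precomp 𝓣 σ` with `Drig' ρ := Drig (σ ρ)` and ALL other fields unchanged; `IsKPX d` transfers.
  I.e. the typed hypothesis package `∀ 𝔇, (∀ E₀, IsKPX) → …` is blind to which representation a
  `(φ,Γ)`-module is "the `D_rig`" of (no functoriality of `Drig` in `Γ`-maps, no Artin dictionary on
  rank one beyond `Drig_rank_one`, no `D_st`/`D_cris` comparison).
* §2 `swapAt` + `nonSplitSteinbergPieces_relabel` + `nonSplitSteinbergPieces_all_reps`: the typed crux
  therefore implies: for every KPX family, every `E₀`, every `E₀`-model `rE` of `ρ|Γ_(K_v)` not in the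
  class of `1`, and EVERY framed `ρB : Γ_(K_v) → GL_n(E₀)` not in the class of `1`, every strict
  all-special triangulation of (any re-framing of) `D_rig(ρB)` has all graded classes non-zero.  In the
  genuine Robba-ring theory this is false: `ρB = χ_cyc ⊕ 1` (n = 2; `K = ℚ(i)`, `p = 5` split, `π` = base
  change of a non-CM elliptic newform multiplicative at 5) has `D_rig(ρB) = 𝓡(x|x|) ⊕ 𝓡(1)`, whose
  coordinate flag is strict (KPX Prop. 6.2.8(1): `H⁰(𝓡(δ₁δ₀⁻¹)) = 0`), special (`dim H²(𝓡(x|x|)) = 1`,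
  KPX Prop. 6.2.8(2)) and SPLIT.  Hence `NonSplitSteinbergPieces ∧ [setting X inhabited] ∧ [a genuine KPX
  datum exists] ⇒ False` — the first conjunct is the misstated one (packaging), see REPAIR.
* §3 `nonSplitSteinbergPieces_false_of_splitModel`: the CHECKED conditional refutation in the form the
  planner can read off: typed crux ∧ X-data ∧ KPX family ∧ [some `ρB ∉ [1]` whose `D_rig` carries, in some
  frame, a strict all-special triangulation with ONE split graded piece] ⇒ `False`.
* §3b `blockDiag`/`stdFlag`/`stdFlag_not_isNonSplitAt`/`stdFlag_isStrict` (general `(φ,Γ)`-ring lemmas: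
  the coordinate flag of `𝓡(d₀) ⊕ 𝓡(d₁)` is a triangulation, SPLIT at every step, and STRICT as soon as
  `dim H⁰_{φ,γ}(𝓡) = 1` and `H⁰_{φ,γ}(𝓡(d₁d₀⁻¹)) = 0`) and `nonSplitSteinbergPieces_false_of_blockModel`
  (n = 2): typed crux ∧ X ∧ KPX family ∧ [`ρB ∉ [1]` with `D_rig(ρB) ≅ 𝓡(d₀) ⊕ 𝓡(d₁)`, the two `H⁰` facts,
  `dim H²(𝓡(d₀d₁⁻¹)) = 1`] ⇒ `False` — every bracketed fact TRUE genuinely for `ρB = χ_cyc ⊕ 1`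
  (`d₀ = x|x|`, `d₁ = 1`; Berger additivity of `D_rig`, KPX Prop. 6.2.8).
* §4 PINS — why `¬S` cannot be landed (and why no item of this route with the X-binders can ever be
  refuted in Lean): `exists_cuspForm_of_cuspidalAutomorphicRepData` (an inhabitant of
  `CuspidalAutomorphicRepData n K hcpt` is a NON-ZERO CUSP FORM on `GL_n(𝔸_K)` — not constructible in
  Mathlib + tree; no named fact can enter a bare `¬S`), and `artinShadow_injective` (ANY
  `PhiGammaModuleData` over `(F, E)` embeds the continuous characters of `Γ_F` into those of `Fˣ`, fixing
  `1` — the shadow of the local Artin map; with `IsKPX` the dimension `dim_E Hom_cont(Fˣ,E) = [F:ℚ_p]+1`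
  is pinned as well — so no KPX datum is constructible today either).
* §5 NEAR-MISS `steinbergWeightVelocityNonSplitSteinbergPieces_refuted : ¬ NonSplitSteinbergPieces` —
  `sorry`, with the obstruction in its docstring (the ONLY sorry of this file).
* §6 (docstring at the end) REPAIR MENU for the planner and the regimes in which the INTENDED statement
  resists (fragment of `ℓ = p` local–global compatibility; open for interior pairs, `n ≥ 3`,
  non-polarisable).

Everything outside §5 is sorry-free; axioms ⊆ {propext, Classical.choice, Quot.sound}.
-/

noncomputable section

set_option linter.dupNamespace false

open Literature.NumberTheory.GaloisRepresentations Literature.NumberTheory.Automorphic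

namespace Summit.Langlands.Langlands.Cruxes.NonSplitSteinbergPieces.Disproof

universe u v w

/-! ## §1 Relabelling blindness of the `(φ,Γ)`-datum -/

section Relabel

variable {p : ℕ} [Fact p.Prime] {F : Type u} [Field F] [TopologicalSpace F]
  {E : Type v} [Field E] [TopologicalSpace E] [IsTopologicalRing E]

/-- `ρ'` is a re-framing of `ρ` (same conjugacy class of framed representations). -/
def SameClass {n : ℕ} (ρ ρ' : FramedGaloisRep F E n) : Prop :=
  ∃ g : GL (Fin n) E, ρ' = FramedRep.conj g ρ

omit [TopologicalSpace F] in
lemma conj_one_eq {n : ℕ} (ρ : FramedGaloisRep F E n) : FramedRep.conj 1 ρ = ρ := by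
  ext g : 1
  simp [FramedRep.conj_apply]

omit [TopologicalSpace F] in
lemma conj_conj_eq {n : ℕ} (g h : GL (Fin n) E) (ρ : FramedGaloisRep F E n) :
    FramedRep.conj h (FramedRep.conj g ρ) = FramedRep.conj (h * g) ρ := by
  ext x : 1
  simp [FramedRep.conj_apply, mul_assoc]

omit [TopologicalSpace F] in
lemma SameClass.refl {n : ℕ} (ρ : FramedGaloisRep F E n) : SameClass ρ ρ :=
  ⟨1, (conj_one_eq ρ).symm⟩

omit [TopologicalSpace F] in
lemma SameClass.symm {n : ℕ} {ρ ρ' : FramedGaloisRep F E n} (h : SameClass ρ ρ') : SameClass ρ' ρ := by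
  obtain ⟨g, rfl⟩ := h
  exact ⟨g⁻¹, by rw [conj_conj_eq, inv_mul_cancel, conj_one_eq]⟩

omit [TopologicalSpace F] in
lemma SameClass.trans {n : ℕ} {ρ ρ' ρ'' : FramedGaloisRep F E n} (h : SameClass ρ ρ')
    (h' : SameClass ρ' ρ'') : SameClass ρ ρ'' := by
  obtain ⟨g, rfl⟩ := h
  obtain ⟨g', rfl⟩ := h'
  exact ⟨g' * g, conj_conj_eq g g' ρ⟩

omit [TopologicalSpace F] in
lemma SameClass.conj {n : ℕ} (g : GL (Fin n) E) (ρ : FramedGaloisRep F E n) :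
    SameClass ρ (FramedRep.conj g ρ) := ⟨g, rfl⟩

variable (F E) in
/-- A **relabelling** of framed Galois representations of `Γ_F` over `E`: in every rank a self-map
that is compatible with re-framing, injective and surjective on conjugacy classes, and fixes `1`.
Precomposing the `Drig` field of a `(φ,Γ)`-datum with it preserves every axiom (§1). -/
structure Relabelling where
  /-- The self-map in rank `n`. -/
  toFun : ∀ {n : ℕ}, FramedGaloisRep F E n → FramedGaloisRep F E n
  /-- Compatible with re-framing. -/
  map_conj : ∀ {n : ℕ} (g : GL (Fin n) E) (ρ : FramedGaloisRep F E n),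
    SameClass (toFun ρ) (toFun (FramedRep.conj g ρ))
  /-- Injective on classes. -/
  reflect : ∀ {n : ℕ} (ρ ρ' : FramedGaloisRep F E n), SameClass (toFun ρ) (toFun ρ') → SameClass ρ ρ'
  /-- Surjective on classes. -/
  hits : ∀ {n : ℕ} (ρ' : FramedGaloisRep F E n), ∃ ρ, SameClass (toFun ρ) ρ'
  /-- Fixes the trivial representation. -/
  map_one : ∀ n : ℕ, toFun (1 : FramedGaloisRep F E n) = 1

/-- The identity relabelling. -/
def Relabelling.id : Relabelling F E where
  toFun := fun ρ => ρ
  map_conj := fun g ρ => SameClass.conj g ρ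
  reflect := fun _ _ h => h
  hits := fun ρ' => ⟨ρ', SameClass.refl ρ'⟩
  map_one := fun _ => rfl

/-- **Precomposition of the `Drig` field with a relabelling** (bare datum): `Drig' ρ := Drig (σ ρ)`,
every other field unchanged; all `PhiGammaModuleData` axioms survive. -/
def precompData (𝔇 : PhiGammaModuleData.{u, v, w} p F E) (σ : Relabelling F E) :
    PhiGammaModuleData.{u, v, w} p F E where
  ring := 𝔇.ring
  smul_eq_self := 𝔇.smul_eq_self
  Drig := fun ρ => 𝔇.Drig (σ.toFun ρ)
  Drig_matGamma_eq_one := fun ρ τ h => 𝔇.Drig_matGamma_eq_one (σ.toFun ρ) τ h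
  Drig_conj := fun g ρ => by
    obtain ⟨h, hh⟩ := σ.map_conj g ρ
    rw [hh]
    exact 𝔇.Drig_conj h _
  Drig_injective := fun ρ ρ' hiso => by
    obtain ⟨g, hg⟩ := 𝔇.Drig_injective _ _ hiso
    exact σ.reflect ρ ρ' ⟨g, hg⟩
  Drig_one := fun n => by
    show (𝔇.Drig (σ.toFun 1)).IsIso _
    rw [σ.map_one]
    exact 𝔇.Drig_one n
  charMod := 𝔇.charMod
  charMod_matGamma_eq_one := 𝔇.charMod_matGamma_eq_one
  charMod_one := 𝔇.charMod_one
  charMod_injective := 𝔇.charMod_injective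
  Drig_rank_one := fun η => 𝔇.Drig_rank_one (σ.toFun η)

/-- **Precomposition of `Drig` with a relabelling** (enriched KPX-style datum): topology, `gen`,
`homToH1`, `IsEtale`, `charMod`, the ring — all unchanged. -/
def precomp (𝓣 : PhiGammaModuleRobba.{u, v, w} p F E) (σ : Relabelling F E) :
    PhiGammaModuleRobba.{u, v, w} p F E :=
  @PhiGammaModuleRobba.mk p _ F _ _ E _ _ _ (precompData 𝓣.toPhiGammaModuleData σ)
    𝓣.topR 𝓣.topRingR 𝓣.continuous_frob 𝓣.continuous_act 𝓣.continuous_orbit 𝓣.gen 𝓣.dense_gen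
    𝓣.homToH1 𝓣.IsEtale

@[simp] lemma precomp_Drig (𝓣 : PhiGammaModuleRobba.{u, v, w} p F E) (σ : Relabelling F E) {n : ℕ}
    (ρ : FramedGaloisRep F E n) : (precomp 𝓣 σ).Drig ρ = 𝓣.Drig (σ.toFun ρ) := rfl

lemma precomp_ring (𝓣 : PhiGammaModuleRobba.{u, v, w} p F E) (σ : Relabelling F E) :
    (precomp 𝓣 σ).ring = 𝓣.ring := rfl

lemma precomp_gen (𝓣 : PhiGammaModuleRobba.{u, v, w} p F E) (σ : Relabelling F E) :
    (precomp 𝓣 σ).gen = 𝓣.gen := rfl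

lemma precomp_charMod (𝓣 : PhiGammaModuleRobba.{u, v, w} p F E) (σ : Relabelling F E) :
    (precomp 𝓣 σ).charMod = 𝓣.charMod := rfl

/-- **`IsKPX` is blind to relabellings of `Drig`.**  The only clause mentioning `Drig` is
`HasDrigEtale`, whose three parts transfer along `σ` (essential surjectivity uses `hits` + `Drig_conj`). -/
theorem isKPX_precomp (𝓣 : PhiGammaModuleRobba.{u, v, w} p F E) (σ : Relabelling F E) {d : ℕ}
    (h : 𝓣.IsKPX d) : (precomp 𝓣 σ).IsKPX d := by
  obtain ⟨hLiu, hR1, hCl, hCFT, hDrig⟩ := h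
  refine ⟨hLiu, hR1, hCl, hCFT, ?_⟩
  obtain ⟨h1, h2, h3⟩ := hDrig
  refine ⟨fun n ρ => h1 n (σ.toFun ρ), h2, fun n D hcyc hcont het => ?_⟩
  obtain ⟨ρ₀, hρ₀⟩ := h3 n D hcyc hcont het
  obtain ⟨ρ, g, hg⟩ := σ.hits ρ₀
  refine ⟨ρ, ?_⟩
  show (𝓣.Drig (σ.toFun ρ)).IsIso D
  have hc : (𝓣.Drig (σ.toFun ρ)).IsIso (𝓣.Drig ρ₀) := by
    rw [hg]
    exact 𝓣.Drig_conj g _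
  exact hc.trans hρ₀

/-! ### The swap relabelling -/

open Classical in
/-- Swap the classes of `r₁` and `r₂` (rank `n₀`), identity elsewhere. -/
def swapFun {n₀ : ℕ} (r₁ r₂ : FramedGaloisRep F E n₀) (ρ : FramedGaloisRep F E n₀) :
    FramedGaloisRep F E n₀ :=
  if SameClass r₁ ρ then r₂ else if SameClass r₂ ρ then r₁ else ρ

omit [TopologicalSpace F] in
lemma swapFun_of_left {n₀ : ℕ} {r₁ r₂ ρ : FramedGaloisRep F E n₀} (h : SameClass r₁ ρ) :
    swapFun r₁ r₂ ρ = r₂ := by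
  simp [swapFun, h]

omit [TopologicalSpace F] in
lemma swapFun_of_right {n₀ : ℕ} {r₁ r₂ ρ : FramedGaloisRep F E n₀} (h₁ : ¬ SameClass r₁ ρ)
    (h₂ : SameClass r₂ ρ) : swapFun r₁ r₂ ρ = r₁ := by
  simp [swapFun, h₁, h₂]

omit [TopologicalSpace F] in
lemma swapFun_of_neither {n₀ : ℕ} {r₁ r₂ ρ : FramedGaloisRep F E n₀} (h₁ : ¬ SameClass r₁ ρ)
    (h₂ : ¬ SameClass r₂ ρ) : swapFun r₁ r₂ ρ = ρ := by
  simp [swapFun, h₁, h₂]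

omit [TopologicalSpace F] in
/-- `swapFun` is class-compatible. -/
lemma swapFun_map_conj {n₀ : ℕ} (r₁ r₂ : FramedGaloisRep F E n₀) (g : GL (Fin n₀) E)
    (ρ : FramedGaloisRep F E n₀) :
    SameClass (swapFun r₁ r₂ ρ) (swapFun r₁ r₂ (FramedRep.conj g ρ)) := by
  have hc : SameClass ρ (FramedRep.conj g ρ) := SameClass.conj g ρ
  by_cases h₁ : SameClass r₁ ρ
  · rw [swapFun_of_left h₁, swapFun_of_left (h₁.trans hc)]
    exact SameClass.refl _
  · have h₁' : ¬ SameClass r₁ (FramedRep.conj g ρ) := fun h => h₁ (h.trans hc.symm)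
    by_cases h₂ : SameClass r₂ ρ
    · rw [swapFun_of_right h₁ h₂, swapFun_of_right h₁' (h₂.trans hc)]
      exact SameClass.refl _
    · have h₂' : ¬ SameClass r₂ (FramedRep.conj g ρ) := fun h => h₂ (h.trans hc.symm)
      rw [swapFun_of_neither h₁ h₂, swapFun_of_neither h₁' h₂']
      exact hc

omit [TopologicalSpace F] in
/-- `swapFun` is injective on classes. -/
lemma swapFun_reflect {n₀ : ℕ} (r₁ r₂ : FramedGaloisRep F E n₀) (ρ ρ' : FramedGaloisRep F E n₀)
    (h : SameClass (swapFun r₁ r₂ ρ) (swapFun r₁ r₂ ρ')) : SameClass ρ ρ' := by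
  by_cases h₁ : SameClass r₁ ρ
  · rw [swapFun_of_left h₁] at h
    by_cases k₁ : SameClass r₁ ρ'
    · exact h₁.symm.trans k₁
    · by_cases k₂ : SameClass r₂ ρ'
      · rw [swapFun_of_right k₁ k₂] at h
        -- `SameClass r₂ r₁`: so `ρ ~ r₁ ~ r₂ ~ ρ'`
        exact h₁.symm.trans (h.symm.trans k₂)
      · rw [swapFun_of_neither k₁ k₂] at h
        exact absurd h k₂
  · by_cases h₂ : SameClass r₂ ρ
    · rw [swapFun_of_right h₁ h₂] at h
      by_cases k₁ : SameClass r₁ ρ'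
      · rw [swapFun_of_left k₁] at h
        exact h₂.symm.trans (h.symm.trans k₁)
      · by_cases k₂ : SameClass r₂ ρ'
        · exact h₂.symm.trans k₂
        · rw [swapFun_of_neither k₁ k₂] at h
          exact absurd h k₁
    · rw [swapFun_of_neither h₁ h₂] at h
      by_cases k₁ : SameClass r₁ ρ'
      · rw [swapFun_of_left k₁] at h
        exact absurd h.symm h₂
      · by_cases k₂ : SameClass r₂ ρ'
        · rw [swapFun_of_right k₁ k₂] at h
          exact absurd h.symm h₁
        · rw [swapFun_of_neither k₁ k₂] at h
          exact h

omit [TopologicalSpace F] in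
/-- `swapFun` is an involution on classes, hence surjective on classes. -/
lemma swapFun_hits {n₀ : ℕ} (r₁ r₂ : FramedGaloisRep F E n₀) (ρ' : FramedGaloisRep F E n₀) :
    SameClass (swapFun r₁ r₂ (swapFun r₁ r₂ ρ')) ρ' := by
  by_cases h₁ : SameClass r₁ ρ'
  · rw [swapFun_of_left h₁]
    by_cases k : SameClass r₁ r₂
    · rw [swapFun_of_left k]
      exact k.symm.trans h₁
    · rw [swapFun_of_right k (SameClass.refl r₂)]
      exact h₁
  · by_cases h₂ : SameClass r₂ ρ'
    · rw [swapFun_of_right h₁ h₂, swapFun_of_left (SameClass.refl r₁)]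
      exact h₂
    · rw [swapFun_of_neither h₁ h₂, swapFun_of_neither h₁ h₂]
      exact SameClass.refl ρ'

/-- Transport of a framed representation along an equality of ranks. -/
def castRep {n m : ℕ} (h : n = m) (ρ : FramedGaloisRep F E n) : FramedGaloisRep F E m := h ▸ ρ

omit [TopologicalSpace F] [IsTopologicalRing E] in
@[simp] lemma castRep_rfl {n : ℕ} (ρ : FramedGaloisRep F E n) : castRep rfl ρ = ρ := rfl

/-- Extend a self-map given in rank `n₀` by the identity in all other ranks. -/
def liftAt (n₀ : ℕ) (f : FramedGaloisRep F E n₀ → FramedGaloisRep F E n₀) {n : ℕ}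
    (ρ : FramedGaloisRep F E n) : FramedGaloisRep F E n :=
  if h : n = n₀ then castRep h.symm (f (castRep h ρ)) else ρ

omit [TopologicalSpace F] [IsTopologicalRing E] in
@[simp] lemma liftAt_self (n₀ : ℕ) (f : FramedGaloisRep F E n₀ → FramedGaloisRep F E n₀)
    (ρ : FramedGaloisRep F E n₀) : liftAt n₀ f ρ = f ρ := by
  simp [liftAt]

omit [TopologicalSpace F] [IsTopologicalRing E] in
lemma liftAt_of_ne {n₀ : ℕ} (f : FramedGaloisRep F E n₀ → FramedGaloisRep F E n₀) {n : ℕ}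
    (h : n ≠ n₀) (ρ : FramedGaloisRep F E n) : liftAt n₀ f ρ = ρ := by
  simp [liftAt, h]

/-- **The swap relabelling**: exchange the classes of `r₁` and `r₂` in rank `n₀` (both off the class
of `1`), identity elsewhere. -/
def swapAt {n₀ : ℕ} (r₁ r₂ : FramedGaloisRep F E n₀) (h₁ : ¬ SameClass r₁ 1) (h₂ : ¬ SameClass r₂ 1) :
    Relabelling F E where
  toFun := fun ρ => liftAt n₀ (swapFun r₁ r₂) ρ
  map_conj := fun {n} g ρ => by
    by_cases h : n = n₀
    · subst h
      rw [liftAt_self, liftAt_self]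
      exact swapFun_map_conj r₁ r₂ g ρ
    · rw [liftAt_of_ne _ h, liftAt_of_ne _ h]
      exact SameClass.conj g ρ
  reflect := fun {n} ρ ρ' hh => by
    by_cases h : n = n₀
    · subst h
      rw [liftAt_self, liftAt_self] at hh
      exact swapFun_reflect r₁ r₂ ρ ρ' hh
    · rwa [liftAt_of_ne _ h, liftAt_of_ne _ h] at hh
  hits := fun {n} ρ' => by
    by_cases h : n = n₀
    · subst h
      refine ⟨swapFun r₁ r₂ ρ', ?_⟩
      rw [liftAt_self]
      exact swapFun_hits r₁ r₂ ρ'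
    · exact ⟨ρ', by rw [liftAt_of_ne _ h]; exact SameClass.refl ρ'⟩
  map_one := fun n => by
    by_cases h : n = n₀
    · subst h
      rw [liftAt_self]
      exact swapFun_of_neither h₁ h₂
    · exact liftAt_of_ne _ h _

omit [TopologicalSpace F] in
lemma swapAt_apply_left {n₀ : ℕ} (r₁ r₂ : FramedGaloisRep F E n₀) (h₁ : ¬ SameClass r₁ 1)
    (h₂ : ¬ SameClass r₂ 1) : (swapAt r₁ r₂ h₁ h₂).toFun r₁ = r₂ := by
  show liftAt n₀ (swapFun r₁ r₂) r₁ = r₂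
  rw [liftAt_self, swapFun_of_left (SameClass.refl r₁)]

end Relabel

/-! ## §2 What the typed crux therefore asserts about EVERY representation -/

section AllReps

open Summit.Langlands.Langlands.Theses.SteinbergWeightVelocity
open scoped NumberField
open IsDedekindDomain

variable {p : ℕ} [Fact p.Prime]

/-- A family of relabellings, one for each coefficient field `E₀`. -/
abbrev RelabelFamily (F : Type) [Field F] [TopologicalSpace F] : Type _ :=
  ∀ (E₀ : IntermediateField ℚ_[p] (PadicAlgCl p)), FiniteDimensional ℚ_[p] E₀ → Relabelling F E₀

open Classical in
/-- The family that is `σ₀` at `E₀` and the identity at every other coefficient field. -/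
def famAt {F : Type} [Field F] [TopologicalSpace F] (E₀ : IntermediateField ℚ_[p] (PadicAlgCl p))
    (σ₀ : Relabelling F E₀) : RelabelFamily (p := p) F :=
  fun E₀' _ => if h : E₀' = E₀ then h ▸ σ₀ else Relabelling.id

lemma famAt_self {F : Type} [Field F] [TopologicalSpace F] (E₀ : IntermediateField ℚ_[p] (PadicAlgCl p))
    (σ₀ : Relabelling F E₀) (hE₀ : FiniteDimensional ℚ_[p] E₀) : famAt E₀ σ₀ E₀ hE₀ = σ₀ := by
  simp [famAt]

/-- **Relabelled form of the typed crux.**  `NonSplitSteinbergPieces` applied to the relabelled KPX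
family `E₀ ↦ precomp (𝔇 E₀) (σ E₀)`: its conclusion is about `D_rig(σ rE)` instead of `D_rig(rE)`,
for ANY family of relabellings `σ`. -/
theorem nonSplitSteinbergPieces_relabel (hS : NonSplitSteinbergPieces)
    (K : Type) [Field K] [NumberField K] [NumberField.IsCMField K] (n : ℕ)
    (hcpt : isCompact_glFiniteIntegralLevel n K) (π : CuspidalAutomorphicRepData n K hcpt)
    (h2 : 2 ≤ n) (hRA : π.1.IsRegularAlgebraic) (ι : PadicAlgCl p ≃+* ℂ)
    (ρ : FramedGaloisRep K (PadicAlgCl p) n) (hss : ρ.toGaloisRep.IsSemisimple)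
    (hcompat : ∀ᶠ v : HeightOneSpectrum (𝓞 K) in Filter.cofinite, ∀ α : Multiset ℂ,
      π.1.HasSatakeParamAt v α → ρ.IsUnramifiedAt v ∧
        ρ.HasFrobCharpolyAt v (arithFrobPolyOfSatake ι v.residueCard n α))
    (v : HeightOneSpectrum (𝓞 K)) (hv : ((p : ℕ) : 𝓞 K) ∈ v.asIdeal)
    (hsec : 3 ≤ n ∨ 2 * (v.asIdeal.ramificationIdx ℤ * v.asIdeal.inertiaDeg ℤ) ≤ Module.finrank ℚ K)
    (hSt : ∀ (L : LocalLanglandsDatum (v.adicCompletion K))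
      (πv : SmoothIrrep (Matrix.GeneralLinearGroup (Fin n) (v.adicCompletion K))),
      π.1.HasLocalComponentAt v πv.ρ → ((L.recGL n (IrrClass.mk πv)).out.1).N ^ (n - 1) ≠ 0)
    (𝔇 : ∀ (E₀ : IntermediateField ℚ_[p] (PadicAlgCl p)), FiniteDimensional ℚ_[p] E₀ →
      PhiGammaModuleRobba.{0, 0, 0} p (v.adicCompletion K) E₀)
    (hKPX : ∀ (E₀ : IntermediateField ℚ_[p] (PadicAlgCl p)) (hE₀ : FiniteDimensional ℚ_[p] E₀),
      (𝔇 E₀ hE₀).IsKPX (v.asIdeal.ramificationIdx ℤ * v.asIdeal.inertiaDeg ℤ))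
    (σ : RelabelFamily (p := p) (v.adicCompletion K))
    (E₀ : IntermediateField ℚ_[p] (PadicAlgCl p)) (hE₀ : FiniteDimensional ℚ_[p] E₀)
    (rE : FramedGaloisRep (v.adicCompletion K) E₀ n) (hrE : HasQlModel (ρ.toLocal v) E₀ rE) :
    ∀ (U : Matrix.GeneralLinearGroup (Fin n) (𝔇 E₀ hE₀).R)
      (Tr : (((𝔇 E₀ hE₀).Drig ((σ E₀ hE₀).toFun rE)).conj U).toPhiGammaModule.Triangulation n),
      (∀ (i : ℕ) (hi : i + 1 < n), Module.finrank E₀ ((𝔇 E₀ hE₀).H2 (Tr.ratioParam i hi).toModule) = 1) →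
      Tr.IsStrict (𝔇 E₀ hE₀).gen → ∀ (i : ℕ) (hi : i + 1 < n), Tr.IsNonSplitAt (𝔇 E₀ hE₀).gen i hi :=
  hS K n hcpt π h2 hRA p ι ρ hss hcompat v hv hsec hSt (fun E₀' hE₀' => precomp (𝔇 E₀' hE₀') (σ E₀' hE₀'))
    (fun E₀' hE₀' => isKPX_precomp _ _ (hKPX E₀' hE₀')) E₀ hE₀ rE hrE

/-- **The typed crux forces non-splitness on `D_rig` of EVERY representation.**  For every KPX family
`𝔇`, every `E₀`, every `E₀`-model `rE` of `ρ|Γ_(K_v)` off the class of `1` and EVERY framed `ρB` off the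
class of `1`: all strict all-special triangulations of any re-framing of `(𝔇 E₀).Drig ρB` have every graded
class non-zero.  (Swap the classes of `rE` and `ρB`.)  This is the formal half of the refutation: in the
genuine theory `ρB = χ_cyc ⊕ 1` violates it (module docstring, §2). -/
theorem nonSplitSteinbergPieces_all_reps (hS : NonSplitSteinbergPieces)
    (K : Type) [Field K] [NumberField K] [NumberField.IsCMField K] (n : ℕ)
    (hcpt : isCompact_glFiniteIntegralLevel n K) (π : CuspidalAutomorphicRepData n K hcpt)
    (h2 : 2 ≤ n) (hRA : π.1.IsRegularAlgebraic) (ι : PadicAlgCl p ≃+* ℂ)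
    (ρ : FramedGaloisRep K (PadicAlgCl p) n) (hss : ρ.toGaloisRep.IsSemisimple)
    (hcompat : ∀ᶠ v : HeightOneSpectrum (𝓞 K) in Filter.cofinite, ∀ α : Multiset ℂ,
      π.1.HasSatakeParamAt v α → ρ.IsUnramifiedAt v ∧
        ρ.HasFrobCharpolyAt v (arithFrobPolyOfSatake ι v.residueCard n α))
    (v : HeightOneSpectrum (𝓞 K)) (hv : ((p : ℕ) : 𝓞 K) ∈ v.asIdeal)
    (hsec : 3 ≤ n ∨ 2 * (v.asIdeal.ramificationIdx ℤ * v.asIdeal.inertiaDeg ℤ) ≤ Module.finrank ℚ K)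
    (hSt : ∀ (L : LocalLanglandsDatum (v.adicCompletion K))
      (πv : SmoothIrrep (Matrix.GeneralLinearGroup (Fin n) (v.adicCompletion K))),
      π.1.HasLocalComponentAt v πv.ρ → ((L.recGL n (IrrClass.mk πv)).out.1).N ^ (n - 1) ≠ 0)
    (𝔇 : ∀ (E₀ : IntermediateField ℚ_[p] (PadicAlgCl p)), FiniteDimensional ℚ_[p] E₀ →
      PhiGammaModuleRobba.{0, 0, 0} p (v.adicCompletion K) E₀)
    (hKPX : ∀ (E₀ : IntermediateField ℚ_[p] (PadicAlgCl p)) (hE₀ : FiniteDimensional ℚ_[p] E₀),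
      (𝔇 E₀ hE₀).IsKPX (v.asIdeal.ramificationIdx ℤ * v.asIdeal.inertiaDeg ℤ))
    (E₀ : IntermediateField ℚ_[p] (PadicAlgCl p)) (hE₀ : FiniteDimensional ℚ_[p] E₀)
    (rE : FramedGaloisRep (v.adicCompletion K) E₀ n) (hrE : HasQlModel (ρ.toLocal v) E₀ rE)
    (hrE1 : ¬ SameClass rE 1)
    (ρB : FramedGaloisRep (v.adicCompletion K) E₀ n) (hρB1 : ¬ SameClass ρB 1) :
    ∀ (U : Matrix.GeneralLinearGroup (Fin n) (𝔇 E₀ hE₀).R)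
      (Tr : (((𝔇 E₀ hE₀).Drig ρB).conj U).toPhiGammaModule.Triangulation n),
      (∀ (i : ℕ) (hi : i + 1 < n), Module.finrank E₀ ((𝔇 E₀ hE₀).H2 (Tr.ratioParam i hi).toModule) = 1) →
      Tr.IsStrict (𝔇 E₀ hE₀).gen → ∀ (i : ℕ) (hi : i + 1 < n), Tr.IsNonSplitAt (𝔇 E₀ hE₀).gen i hi := by
  have key := nonSplitSteinbergPieces_relabel hS K n hcpt π h2 hRA ι ρ hss hcompat v hv hsec hSt 𝔇 hKPX
    (famAt E₀ (swapAt rE ρB hrE1 hρB1)) E₀ hE₀ rE hrE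
  have e : (famAt (p := p) E₀ (swapAt rE ρB hrE1 hρB1) E₀ hE₀).toFun rE = ρB := by
    rw [famAt_self, swapAt_apply_left]
  rw [e] at key
  exact key

/-! ## §3 The conditional refutation (checked) -/

/-- **CONDITIONAL REFUTATION.**  The typed crux, one instance of the setting X (a CM field `K`, a
regular algebraic cuspidal `π` on `GL_n`, `n ≥ 2`, … , a place `v ∣ p` in the sector with `π_v` of
Steinberg type), ONE KPX family `𝔇`, and — at one coefficient field `E₀` — an `E₀`-model `rE ∉ [1]` of
`ρ|Γ_(K_v)` together with ANY framed `ρB ∉ [1]` whose `D_rig` carries (in some frame `U`) a strict,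
all-special triangulation with ONE split graded piece, are jointly contradictory.  In the genuine theory
the last bracket is inhabited by `ρB = χ_cyc ⊕ 1` (coordinate flag of `𝓡(x|x|) ⊕ 𝓡(1)`; KPX Prop. 6.2.8),
so the typed crux is false as soon as X is inhabited and a genuine KPX datum exists: the misstatement is
the `∀ 𝔇 / IsKPX` packaging, which cannot tell `D_rig(ρ_(π,v))` from `D_rig(χ ⊕ 1)`. -/
theorem nonSplitSteinbergPieces_false_of_splitModel (hS : NonSplitSteinbergPieces)
    (K : Type) [Field K] [NumberField K] [NumberField.IsCMField K] (n : ℕ)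
    (hcpt : isCompact_glFiniteIntegralLevel n K) (π : CuspidalAutomorphicRepData n K hcpt)
    (h2 : 2 ≤ n) (hRA : π.1.IsRegularAlgebraic) (ι : PadicAlgCl p ≃+* ℂ)
    (ρ : FramedGaloisRep K (PadicAlgCl p) n) (hss : ρ.toGaloisRep.IsSemisimple)
    (hcompat : ∀ᶠ v : HeightOneSpectrum (𝓞 K) in Filter.cofinite, ∀ α : Multiset ℂ,
      π.1.HasSatakeParamAt v α → ρ.IsUnramifiedAt v ∧
        ρ.HasFrobCharpolyAt v (arithFrobPolyOfSatake ι v.residueCard n α))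
    (v : HeightOneSpectrum (𝓞 K)) (hv : ((p : ℕ) : 𝓞 K) ∈ v.asIdeal)
    (hsec : 3 ≤ n ∨ 2 * (v.asIdeal.ramificationIdx ℤ * v.asIdeal.inertiaDeg ℤ) ≤ Module.finrank ℚ K)
    (hSt : ∀ (L : LocalLanglandsDatum (v.adicCompletion K))
      (πv : SmoothIrrep (Matrix.GeneralLinearGroup (Fin n) (v.adicCompletion K))),
      π.1.HasLocalComponentAt v πv.ρ → ((L.recGL n (IrrClass.mk πv)).out.1).N ^ (n - 1) ≠ 0)
    (𝔇 : ∀ (E₀ : IntermediateField ℚ_[p] (PadicAlgCl p)), FiniteDimensional ℚ_[p] E₀ →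
      PhiGammaModuleRobba.{0, 0, 0} p (v.adicCompletion K) E₀)
    (hKPX : ∀ (E₀ : IntermediateField ℚ_[p] (PadicAlgCl p)) (hE₀ : FiniteDimensional ℚ_[p] E₀),
      (𝔇 E₀ hE₀).IsKPX (v.asIdeal.ramificationIdx ℤ * v.asIdeal.inertiaDeg ℤ))
    (E₀ : IntermediateField ℚ_[p] (PadicAlgCl p)) (hE₀ : FiniteDimensional ℚ_[p] E₀)
    (rE : FramedGaloisRep (v.adicCompletion K) E₀ n) (hrE : HasQlModel (ρ.toLocal v) E₀ rE)
    (hrE1 : ¬ SameClass rE 1)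
    (ρB : FramedGaloisRep (v.adicCompletion K) E₀ n) (hρB1 : ¬ SameClass ρB 1)
    (U : Matrix.GeneralLinearGroup (Fin n) (𝔇 E₀ hE₀).R)
    (Tr : (((𝔇 E₀ hE₀).Drig ρB).conj U).toPhiGammaModule.Triangulation n)
    (hspecial : ∀ (i : ℕ) (hi : i + 1 < n),
      Module.finrank E₀ ((𝔇 E₀ hE₀).H2 (Tr.ratioParam i hi).toModule) = 1)
    (hstrict : Tr.IsStrict (𝔇 E₀ hE₀).gen)
    (i : ℕ) (hi : i + 1 < n) (hsplit : ¬ Tr.IsNonSplitAt (𝔇 E₀ hE₀).gen i hi) : False :=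
  hsplit (nonSplitSteinbergPieces_all_reps hS K n hcpt π h2 hRA ι ρ hss hcompat v hv hsec hSt 𝔇 hKPX
    E₀ hE₀ rE hrE hrE1 ρB hρB1 U Tr hspecial hstrict i hi)

end AllReps

/-! ## §3b The block-diagonal model: which rank-one facts make the split flag strict and special

General `(φ,Γ)`-ring lemmas (any `PhiGammaRing Γ E`): the block-diagonal framed module `blockDiag d` of
rank-one data `d`, its coordinate flag `stdFlag d` (a `Triangulation` with parameters `d`), the vanishing of
all its graded cocycles (`stdFlag_not_isNonSplitAt` — SPLIT at every step), and, in rank two, its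
STRICTNESS from the two rank-one facts `dim_E H⁰_{φ,γ₀}(𝓡) = 1`, `H⁰_{φ,γ₀}(𝓡(d₁d₀⁻¹)) = 0`
(`stdFlag_isStrict`).  Then `nonSplitSteinbergPieces_false_of_blockModel`: the typed crux is contradictory
with any KPX family in which some `ρB ∉ [1]` has `D_rig(ρB) ≅ 𝓡(d₀) ⊕ 𝓡(d₁)` with these two `H⁰` facts and
`dim H²(𝓡(d₀d₁⁻¹)) = 1` — all TRUE in the genuine theory for `ρB = χ_cyc ⊕ 1`, `d₀ = x|x|`, `d₁ = 1`
(Berger: `D_rig` is additive and `D_rig(χ_cyc) = 𝓡(x|x|)`; KPX Prop. 6.2.8: `H⁰(𝓡(δ)) ≠ 0` iff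
`δ = x^{-k}`, `k ∈ ℕ`; `dim H²(𝓡(x^k|x|)) = 1` for `k ≥ 1`; `H⁰(𝓡) = E`). -/

section BlockModel

variable {Γ : Type u} [Group Γ] {E : Type v} [CommRing E] {𝓡 : PhiGammaRing.{u, v, w} Γ E}

open PhiGammaModule PhiGammaRing

/-! ### Diagonal framed modules -/

lemma gammaGL_glDiagonal {m : ℕ} (γ : Γ) (u : Fin m → 𝓡.Rˣ) :
    𝓡.gammaGL m γ (glDiagonal m 𝓡.R u) = glDiagonal m 𝓡.R (fun i => 𝓡.smulUnits γ (u i)) := by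
  refine Matrix.GeneralLinearGroup.ext fun i j => ?_
  rw [PhiGammaRing.gammaGL_apply]
  rw [coe_glDiagonal, coe_glDiagonal, Matrix.diagonal_apply, Matrix.diagonal_apply]
  split_ifs <;> simp

lemma phiGL_glDiagonal {m : ℕ} (u : Fin m → 𝓡.Rˣ) :
    𝓡.phiGL m (glDiagonal m 𝓡.R u) = glDiagonal m 𝓡.R (fun i => 𝓡.frobUnits (u i)) := by
  refine Matrix.GeneralLinearGroup.ext fun i j => ?_
  rw [PhiGammaRing.phiGL_apply]
  rw [coe_glDiagonal, coe_glDiagonal, Matrix.diagonal_apply, Matrix.diagonal_apply]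
  split_ifs <;> simp

/-- The **block-diagonal** framed module `𝓡(d₀) ⊕ ⋯ ⊕ 𝓡(d_{m-1})` of a family of rank-one data. -/
def blockDiag {m : ℕ} (d : Fin m → 𝓡.RankOneDatum) : FramedPhiGammaModule 𝓡 m where
  matPhi := glDiagonal m 𝓡.R (fun i => (d i).α)
  matGamma γ := glDiagonal m 𝓡.R (fun i => (d i).c γ)
  matGamma_mul γ γ' := by
    rw [gammaGL_glDiagonal, ← map_mul]
    congr 1
    funext i
    exact Units.ext (by simp [(d i).c_mul γ γ'])
  matPhi_mul γ := by
    rw [phiGL_glDiagonal, gammaGL_glDiagonal, ← map_mul, ← map_mul]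
    congr 1
    funext i
    refine Units.ext ?_
    simp only [Pi.mul_apply, Units.val_mul, val_frobUnits, val_smulUnits]
    linear_combination -((d i).compat γ)

@[simp] lemma blockDiag_matPhi {m : ℕ} (d : Fin m → 𝓡.RankOneDatum) :
    ((blockDiag d).matPhi : Matrix (Fin m) (Fin m) 𝓡.R) = Matrix.diagonal fun i => ((d i).α : 𝓡.R) := rfl

@[simp] lemma blockDiag_matGamma {m : ℕ} (d : Fin m → 𝓡.RankOneDatum) (γ : Γ) :
    ((blockDiag d).matGamma γ : Matrix (Fin m) (Fin m) 𝓡.R) = Matrix.diagonal fun i => ((d i).c γ : 𝓡.R) := rfl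

lemma blockDiag_isTriangularWith {m : ℕ} (d : Fin m → 𝓡.RankOneDatum) :
    (blockDiag d).IsTriangularWith (fun i => ((d i).α : 𝓡.R)) (fun i γ => ((d i).c γ : 𝓡.R)) := by
  refine ⟨?_, fun i => ?_, fun γ => ⟨?_, fun i => ?_⟩⟩
  · rw [blockDiag_matPhi]; exact Matrix.blockTriangular_diagonal _
  · rw [blockDiag_matPhi, Matrix.diagonal_apply_eq]
  · rw [blockDiag_matGamma]; exact Matrix.blockTriangular_diagonal _
  · rw [blockDiag_matGamma, Matrix.diagonal_apply_eq]

/-- The **standard (coordinate) flag** of a block-diagonal module, as a triangulation with parameters `d`. -/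
def stdFlag {m : ℕ} (d : Fin m → 𝓡.RankOneDatum) : (blockDiag d).toPhiGammaModule.Triangulation m :=
  Triangulation.ofTriangular (blockDiag d) d (blockDiag_isTriangularWith d)

@[simp] lemma stdFlag_basis {m : ℕ} (d : Fin m → 𝓡.RankOneDatum) :
    (stdFlag d).basis = Pi.basisFun 𝓡.R (Fin m) := rfl

@[simp] lemma stdFlag_param {m : ℕ} (d : Fin m → 𝓡.RankOneDatum) (i : Fin m) :
    (stdFlag d).param i = d i := rfl

lemma stdFlag_phiCoeff {m : ℕ} (d : Fin m → 𝓡.RankOneDatum) (i : ℕ) (hi : i + 1 < m) :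
    (stdFlag d).phiCoeff i hi = 0 := by
  unfold Triangulation.phiCoeff
  rw [stdFlag_basis, Triangulation.basisFun_coord_apply, Pi.basisFun_apply,
    FramedPhiGammaModule.toPhiGammaModule_phi_apply, FramedPhiGammaModule.phiOp_single, blockDiag_matPhi,
    Matrix.diagonal_apply_ne]
  exact fun h => by simp [Fin.ext_iff] at h

lemma stdFlag_actCoeff {m : ℕ} (d : Fin m → 𝓡.RankOneDatum) (i : ℕ) (hi : i + 1 < m) (γ : Γ) :
    (stdFlag d).actCoeff i hi γ = 0 := by
  unfold Triangulation.actCoeff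
  rw [stdFlag_basis, Triangulation.basisFun_coord_apply, Pi.basisFun_apply,
    FramedPhiGammaModule.toPhiGammaModule_act_apply, FramedPhiGammaModule.gammaOp_single, blockDiag_matGamma,
    Matrix.diagonal_apply_ne]
  exact fun h => by simp [Fin.ext_iff] at h

/-- **The standard flag of a block-diagonal module is SPLIT at every step** (its graded cocycles vanish). -/
theorem stdFlag_not_isNonSplitAt {m : ℕ} (d : Fin m → 𝓡.RankOneDatum) (γ₀ : Γ) (i : ℕ) (hi : i + 1 < m) :
    ¬ (stdFlag d).IsNonSplitAt γ₀ i hi := by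
  simp only [Triangulation.IsNonSplitAt, ne_eq, not_not, Triangulation.gradedClass]
  have h0 : (stdFlag d).gradedCocycle γ₀ i hi = 0 := by
    simp [Triangulation.gradedCocycle, stdFlag_phiCoeff, stdFlag_actCoeff]
  have : (⟨(stdFlag d).gradedCocycle γ₀ i hi, (stdFlag d).gradedCocycle_mem_Z1 γ₀ i hi⟩ :
      ↥(((stdFlag d).ratioParam i hi).toModule.Z1 γ₀)) = 0 := Subtype.ext h0
  rw [this, Submodule.Quotient.mk_zero]

/-! ### Strictness of the standard flag (rank two) from rank-one `H⁰` data -/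

section HerrTransport

variable {V W A B : Type*} [AddCommGroup V] [Module E V] [AddCommGroup W] [Module E W]
  [AddCommGroup A] [Module E A] [AddCommGroup B] [Module E B]

omit [Group Γ] in
/-- `H⁰` is transported along a linear equivalence intertwining the two operators. -/
lemma H0_comap_eq (e : V ≃ₗ[E] W) (f g : V →ₗ[E] V) (f' g' : W →ₗ[E] W)
    (hf : ∀ x, e (f x) = f' (e x)) (hg : ∀ x, e (g x) = g' (e x)) :
    (Herr.H0 f' g').comap (e : V →ₗ[E] W) = Herr.H0 f g := by
  ext x
  simp only [Submodule.mem_comap, Herr.mem_H0_iff, LinearEquiv.coe_coe, ← hf, ← hg, e.injective.eq_iff]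

omit [Group Γ] in
/-- The induced equivalence `H⁰(f, g) ≃ H⁰(f', g')`. -/
def H0Equiv (e : V ≃ₗ[E] W) (f g : V →ₗ[E] V) (f' g' : W →ₗ[E] W)
    (hf : ∀ x, e (f x) = f' (e x)) (hg : ∀ x, e (g x) = g' (e x)) :
    Herr.H0 f g ≃ₗ[E] Herr.H0 f' g' :=
  (LinearEquiv.ofEq _ _ (H0_comap_eq e f g f' g' hf hg).symm).trans (LinearEquiv.ofSubmodule' e _)

omit [Group Γ] in
/-- `H⁰` of a product of operator pairs whose second factor has `H⁰ = 0` is `H⁰` of the first factor. -/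
def H0ProdEquivOfBot (F₀ G₀ : A →ₗ[E] A) (F₁ G₁ : B →ₗ[E] B) (h : Herr.H0 F₁ G₁ = ⊥) :
    Herr.H0 (F₀.prodMap F₁) (G₀.prodMap G₁) ≃ₗ[E] Herr.H0 F₀ G₀ where
  toFun x := ⟨x.1.1, by
    have hx := x.2
    rw [Herr.mem_H0_iff] at hx ⊢
    exact ⟨congrArg Prod.fst hx.1, congrArg Prod.fst hx.2⟩⟩
  map_add' x y := rfl
  map_smul' c x := rfl
  invFun a := ⟨(a.1, 0), by
    have ha := a.2
    rw [Herr.mem_H0_iff] at ha ⊢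
    simp [LinearMap.prodMap_apply, ha.1, ha.2]⟩
  left_inv x := by
    have hx := x.2
    rw [Herr.mem_H0_iff] at hx
    have h2 : x.1.2 ∈ Herr.H0 F₁ G₁ := by
      rw [Herr.mem_H0_iff]
      exact ⟨congrArg Prod.snd hx.1, congrArg Prod.snd hx.2⟩
    rw [h, Submodule.mem_bot] at h2
    refine Subtype.ext (Prod.ext rfl ?_)
    simp [h2]
  right_inv a := rfl

end HerrTransport

section StrictTwo

variable (d : Fin 2 → 𝓡.RankOneDatum) (γ₀ : Γ)

/-- The `φ`-entries of the block module: `(φ x)_j = α_j φ(x_j)`. -/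
lemma blockDiag_phi_apply {m : ℕ} (d : Fin m → 𝓡.RankOneDatum) (x : Fin m → 𝓡.R) (j : Fin m) :
    (blockDiag d).toPhiGammaModule.phi x j = ((d j).α : 𝓡.R) * 𝓡.frob (x j) := by
  rw [FramedPhiGammaModule.toPhiGammaModule_phi_apply, FramedPhiGammaModule.phiOp, blockDiag_matPhi,
    Matrix.mulVec_diagonal]
  rfl

/-- The `γ`-entries of the block module: `(γ x)_j = c_j(γ) γ(x_j)`. -/
lemma blockDiag_act_apply {m : ℕ} (d : Fin m → 𝓡.RankOneDatum) (γ : Γ) (x : Fin m → 𝓡.R) (j : Fin m) :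
    (blockDiag d).toPhiGammaModule.act γ x j = ((d j).c γ : 𝓡.R) * γ • x j := by
  rw [FramedPhiGammaModule.toPhiGammaModule_act_apply, FramedPhiGammaModule.gammaOp, blockDiag_matGamma,
    Matrix.mulVec_diagonal]
  rfl

/-- Step `0`: the quotient by `Fil₀ = 0` is the whole module. -/
def quotFil0Equiv : ((Fin 2 → 𝓡.R) ⧸ ((stdFlag d).Fil ((0 : Fin 2) : ℕ)).restrictScalars E) ≃ₗ[E]
    (𝓡.R × 𝓡.R) :=
  (Submodule.quotEquivOfEqBot _ (by
    rw [show (stdFlag d).Fil ((0 : Fin 2) : ℕ) = ⊥ from fil_zero _, Submodule.restrictScalars_bot])).trans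
    (LinearEquiv.finTwoArrow E 𝓡.R)

lemma quotFil0Equiv_mk (x : Fin 2 → 𝓡.R) :
    quotFil0Equiv d (Submodule.Quotient.mk x) = (x 0, x 1) := by
  rw [quotFil0Equiv, LinearEquiv.trans_apply, Submodule.quotEquivOfEqBot_apply_mk]
  rfl

/-- Step `1`: the quotient by `Fil₁ = ⟨e₀⟩` is the second coordinate. -/
def sndE : (Fin 2 → 𝓡.R) →ₗ[E] 𝓡.R :=
  (LinearMap.proj (1 : Fin 2) : (Fin 2 → 𝓡.R) →ₗ[𝓡.R] 𝓡.R).restrictScalars E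

lemma sndE_apply (x : Fin 2 → 𝓡.R) : sndE (𝓡 := 𝓡) x = x 1 := rfl

lemma sndE_surjective : Function.Surjective (sndE (𝓡 := 𝓡)) :=
  fun r => ⟨fun _ => r, rfl⟩

lemma ker_sndE : LinearMap.ker (sndE (𝓡 := 𝓡)) = ((stdFlag d).Fil ((1 : Fin 2) : ℕ)).restrictScalars E := by
  ext x
  rw [LinearMap.mem_ker, sndE_apply, Submodule.restrictScalars_mem, Triangulation.Fil, stdFlag_basis,
    mem_fil_iff]
  constructor
  · intro h j hj
    have : j = 1 := by omega
    subst this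
    rw [Triangulation.basisFun_coord_apply]; exact h
  · intro h
    have := h 1 (le_refl _)
    rwa [Triangulation.basisFun_coord_apply] at this

def quotFil1Equiv : ((Fin 2 → 𝓡.R) ⧸ ((stdFlag d).Fil ((1 : Fin 2) : ℕ)).restrictScalars E) ≃ₗ[E] 𝓡.R :=
  (Submodule.quotEquivOfEq _ _ (ker_sndE d).symm).trans
    ((sndE (𝓡 := 𝓡)).quotKerEquivOfSurjective sndE_surjective)

lemma quotFil1Equiv_mk (x : Fin 2 → 𝓡.R) :
    quotFil1Equiv d (Submodule.Quotient.mk x) = x 1 := by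
  rw [quotFil1Equiv, LinearEquiv.trans_apply, Submodule.quotEquivOfEq_mk,
    LinearMap.quotKerEquivOfSurjective_apply_mk, sndE_apply]

/-- **Strictness at step 0** of the standard flag of `𝓡(d₀) ⊕ 𝓡(d₁)`: `H⁰((D/Fil₀)(d₀⁻¹)) = H⁰(𝓡) ⊕ H⁰(𝓡(d₁d₀⁻¹))`
is a line as soon as `dim H⁰_{φ,γ₀}(𝓡) = 1` and `H⁰_{φ,γ₀}(𝓡(d₁ d₀⁻¹)) = 0`. -/
theorem stdFlag_isStrictAt_zero
    (hunit : Module.finrank E ((PhiGammaModule.unit 𝓡).H0 γ₀) = 1)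
    (hratio : ((d 1) * (d 0)⁻¹).toModule.H0 γ₀ = ⊥) :
    (stdFlag d).IsStrictAt γ₀ 0 := by
  unfold Triangulation.IsStrictAt
  set F₀ := (PhiGammaModule.unit 𝓡).phiₗ
  set G₀ := (PhiGammaModule.unit 𝓡).actₗ γ₀
  set F₁ := ((d 1) * (d 0)⁻¹).toModule.phiₗ
  set G₁ := ((d 1) * (d 0)⁻¹).toModule.actₗ γ₀
  have e := H0Equiv (quotFil0Equiv d) ((stdFlag d).quotTwistPhi 0) ((stdFlag d).quotTwistAct γ₀ 0)
    (F₀.prodMap F₁) (G₀.prodMap G₁) ?hf ?hg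
  · rw [LinearEquiv.finrank_eq e, LinearEquiv.finrank_eq (H0ProdEquivOfBot F₀ G₀ F₁ G₁ hratio), hunit]
  case hf =>
    intro q
    induction q using Submodule.Quotient.induction_on with
    | H x =>
      rw [Triangulation.quotTwistPhi, Submodule.mapQ_apply, quotFil0Equiv_mk, quotFil0Equiv_mk,
        LinearMap.prodMap_apply]
      simp only [phiₗ_apply, twist_phi_apply, stdFlag_param, Pi.smul_apply, smul_eq_mul, blockDiag_phi_apply,
        F₀, F₁, unit_phi_apply, RankOneDatum.toModule_phi_apply, RankOneDatum.mul_α, RankOneDatum.inv_α,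
        Units.val_mul]
      refine Prod.ext ?_ ?_
      · simp only
        rw [← mul_assoc, Units.inv_mul, one_mul]
      · simp only
        ring
  case hg =>
    intro q
    induction q using Submodule.Quotient.induction_on with
    | H x =>
      rw [Triangulation.quotTwistAct, Submodule.mapQ_apply, quotFil0Equiv_mk, quotFil0Equiv_mk,
        LinearMap.prodMap_apply]
      simp only [actₗ_apply, twist_act_apply, stdFlag_param, Pi.smul_apply, smul_eq_mul, blockDiag_act_apply,
        G₀, G₁, unit_act_apply, RankOneDatum.toModule_act_apply, RankOneDatum.mul_c, RankOneDatum.inv_c,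
        Units.val_mul]
      refine Prod.ext ?_ ?_
      · simp only
        rw [← mul_assoc, Units.inv_mul, one_mul]
      · simp only
        ring

/-- **Strictness at step 1**: `H⁰((D/Fil₁)(d₁⁻¹)) = H⁰(𝓡)` is a line as soon as `dim H⁰_{φ,γ₀}(𝓡) = 1`. -/
theorem stdFlag_isStrictAt_one (hunit : Module.finrank E ((PhiGammaModule.unit 𝓡).H0 γ₀) = 1) :
    (stdFlag d).IsStrictAt γ₀ 1 := by
  unfold Triangulation.IsStrictAt
  have e := H0Equiv (quotFil1Equiv d) ((stdFlag d).quotTwistPhi 1) ((stdFlag d).quotTwistAct γ₀ 1)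
    (PhiGammaModule.unit 𝓡).phiₗ ((PhiGammaModule.unit 𝓡).actₗ γ₀) ?hf ?hg
  · rw [LinearEquiv.finrank_eq e, hunit]
  case hf =>
    intro q
    induction q using Submodule.Quotient.induction_on with
    | H x =>
      rw [Triangulation.quotTwistPhi, Submodule.mapQ_apply, quotFil1Equiv_mk, quotFil1Equiv_mk]
      simp only [phiₗ_apply, twist_phi_apply, stdFlag_param, Pi.smul_apply, smul_eq_mul, blockDiag_phi_apply,
        unit_phi_apply, RankOneDatum.inv_α]
      rw [← mul_assoc, Units.inv_mul, one_mul]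
  case hg =>
    intro q
    induction q using Submodule.Quotient.induction_on with
    | H x =>
      rw [Triangulation.quotTwistAct, Submodule.mapQ_apply, quotFil1Equiv_mk, quotFil1Equiv_mk]
      simp only [actₗ_apply, twist_act_apply, stdFlag_param, Pi.smul_apply, smul_eq_mul, blockDiag_act_apply,
        unit_act_apply, RankOneDatum.inv_c]
      rw [← mul_assoc, Units.inv_mul, one_mul]

/-- **The standard flag of `𝓡(d₀) ⊕ 𝓡(d₁)` is STRICT** under the two rank-one `H⁰` conditions
(both hold in the genuine Robba-ring theory for `d₀ = x|x|`, `d₁ = 1`: KPX Prop. 6.2.8(1)). -/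
theorem stdFlag_isStrict (hunit : Module.finrank E ((PhiGammaModule.unit 𝓡).H0 γ₀) = 1)
    (hratio : ((d 1) * (d 0)⁻¹).toModule.H0 γ₀ = ⊥) : (stdFlag d).IsStrict γ₀ := by
  intro i
  fin_cases i
  · exact stdFlag_isStrictAt_zero d γ₀ hunit hratio
  · exact stdFlag_isStrictAt_one d γ₀ hunit

end StrictTwo

end BlockModel

section BlockRefutation

open Summit.Langlands.Langlands.Theses.SteinbergWeightVelocity
open scoped NumberField
open IsDedekindDomain PhiGammaModule

variable {p : ℕ} [Fact p.Prime]

/-- **CONDITIONAL REFUTATION, block form (n = 2).**  Typed crux ∧ setting X at `n = 2` (sector clause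
`2·e_v f_v ≤ [K:ℚ]`) ∧ a KPX family `𝔇` ∧ at one `E₀`: an `E₀`-model `rE ∉ [1]` of `ρ|Γ_(K_v)` and a framed
`ρB ∉ [1]` with `D_rig(ρB) ≅ 𝓡(d₀) ⊕ 𝓡(d₁)` (some frame), `dim_E₀ H⁰_{φ,γ}(𝓡) = 1`, `H⁰_{φ,γ}(𝓡(d₁d₀⁻¹)) = 0`,
`dim_E₀ H²(𝓡(d₀d₁⁻¹)) = 1` ⟹ `False`.  (The coordinate flag of the block module is then a strict, special,
SPLIT triangulation, contradicting `nonSplitSteinbergPieces_all_reps`.)  Every bracketed condition holds in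
the genuine theory for `ρB = χ_cyc ⊕ 1` — so this is the refutation of the typed crux modulo inhabiting X and
the KPX interface, neither of which Lean can do today (§4). -/
theorem nonSplitSteinbergPieces_false_of_blockModel (hS : NonSplitSteinbergPieces)
    (K : Type) [Field K] [NumberField K] [NumberField.IsCMField K]
    (hcpt : isCompact_glFiniteIntegralLevel 2 K) (π : CuspidalAutomorphicRepData 2 K hcpt)
    (hRA : π.1.IsRegularAlgebraic) (ι : PadicAlgCl p ≃+* ℂ)
    (ρ : FramedGaloisRep K (PadicAlgCl p) 2) (hss : ρ.toGaloisRep.IsSemisimple)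
    (hcompat : ∀ᶠ v : HeightOneSpectrum (𝓞 K) in Filter.cofinite, ∀ α : Multiset ℂ,
      π.1.HasSatakeParamAt v α → ρ.IsUnramifiedAt v ∧
        ρ.HasFrobCharpolyAt v (arithFrobPolyOfSatake ι v.residueCard 2 α))
    (v : HeightOneSpectrum (𝓞 K)) (hv : ((p : ℕ) : 𝓞 K) ∈ v.asIdeal)
    (hsector : 2 * (v.asIdeal.ramificationIdx ℤ * v.asIdeal.inertiaDeg ℤ) ≤ Module.finrank ℚ K)
    (hSt : ∀ (L : LocalLanglandsDatum (v.adicCompletion K))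
      (πv : SmoothIrrep (Matrix.GeneralLinearGroup (Fin 2) (v.adicCompletion K))),
      π.1.HasLocalComponentAt v πv.ρ → ((L.recGL 2 (IrrClass.mk πv)).out.1).N ^ (2 - 1) ≠ 0)
    (𝔇 : ∀ (E₀ : IntermediateField ℚ_[p] (PadicAlgCl p)), FiniteDimensional ℚ_[p] E₀ →
      PhiGammaModuleRobba.{0, 0, 0} p (v.adicCompletion K) E₀)
    (hKPX : ∀ (E₀ : IntermediateField ℚ_[p] (PadicAlgCl p)) (hE₀ : FiniteDimensional ℚ_[p] E₀),
      (𝔇 E₀ hE₀).IsKPX (v.asIdeal.ramificationIdx ℤ * v.asIdeal.inertiaDeg ℤ))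
    (E₀ : IntermediateField ℚ_[p] (PadicAlgCl p)) (hE₀ : FiniteDimensional ℚ_[p] E₀)
    (rE : FramedGaloisRep (v.adicCompletion K) E₀ 2) (hrE : HasQlModel (ρ.toLocal v) E₀ rE)
    (hrE1 : ¬ SameClass rE 1)
    (ρB : FramedGaloisRep (v.adicCompletion K) E₀ 2) (hρB1 : ¬ SameClass ρB 1)
    (d : Fin 2 → (𝔇 E₀ hE₀).ring.RankOneDatum)
    (hD : ∃ U : Matrix.GeneralLinearGroup (Fin 2) (𝔇 E₀ hE₀).R, ((𝔇 E₀ hE₀).Drig ρB).conj U = blockDiag d)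
    (hunit : Module.finrank E₀ ((PhiGammaModule.unit (𝔇 E₀ hE₀).ring).H0 (𝔇 E₀ hE₀).gen) = 1)
    (hratio : ((d 1) * (d 0)⁻¹).toModule.H0 (𝔇 E₀ hE₀).gen = ⊥)
    (hspecial : Module.finrank E₀ ((𝔇 E₀ hE₀).H2 ((d 0) * (d 1)⁻¹).toModule) = 1) : False := by
  obtain ⟨U, hU⟩ := hD
  have key := nonSplitSteinbergPieces_all_reps hS K 2 hcpt π le_rfl hRA ι ρ hss hcompat v hv (Or.inr hsector)
    hSt 𝔇 hKPX E₀ hE₀ rE hrE hrE1 ρB hρB1 U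
  rw [hU] at key
  have hsp : ∀ (i : ℕ) (hi : i + 1 < 2),
      Module.finrank E₀ ((𝔇 E₀ hE₀).H2 ((stdFlag d).ratioParam i hi).toModule) = 1 := by
    intro i hi
    obtain rfl : i = 0 := by omega
    exact hspecial
  exact stdFlag_not_isNonSplitAt d (𝔇 E₀ hE₀).gen 0 (by omega)
    (key (stdFlag d) hsp (stdFlag_isStrict d (𝔇 E₀ hE₀).gen hunit hratio) 0 (by omega))

end BlockRefutation

/-! ## §4 PINS — why `¬ NonSplitSteinbergPieces` cannot be landed in Lean

`¬S` is an existential: it must EXHIBIT the outer data of the setting X and a KPX family.  Two of these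
types have no constructible inhabitant in Mathlib + tree (and a bare `¬S` cannot assume named facts):

1. `π : CuspidalAutomorphicRepData n K hcpt` (`n ≥ 2`).  Such a `π` is `W' < W ≤ cuspFormsGL n K hcpt`
   (`AutomorphicRepData.lt`), hence yields a NON-ZERO GENUINE CUSP FORM `φ : GL_n(𝔸_K) → ℂ`
   (`IsCuspFormGL`: automorphic — left `GL_n(K)`-invariant, smooth, `K_∞`- and `Z(𝔤)`-finite, of
   moderate growth — with all constant terms vanishing), `exists_cuspForm_of_cuspidalAutomorphicRepData`.
   Nobody can write one down in Lean today (no Eisenstein/Poincaré/theta series, no converse theorem,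
   no modularity theorem as a THEOREM — all are named-fact `Prop`s).  The constant function fails the cusp
   condition (fundamental domains of `K ⊂ 𝔸_K` have positive Haar measure), so there is no junk `π` either.
   CONSEQUENCE: no item of this route carrying the X-binders (13448, 13450–13455) is refutable in Lean;
   refutations of such items are necessarily on paper (this file) + planner repair.
2. `𝔇 E₀ hE₀ : PhiGammaModuleRobba p K_v E₀` with `IsKPX`.  Already the bare `PhiGammaModuleData`
   axioms (`Drig_rank_one`, `charMod_injective`, `Drig_injective`) force an INJECTION of the continuous
   characters `Γ_(K_v) → E₀ˣ` into the continuous characters `K_vˣ → E₀ˣ` fixing `1`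
   (`artinShadow_injective`, `artinShadow_one`) — the shadow of the local Artin map; `IsKPX` moreover
   pins `dim_E₀ Hom_cont(K_vˣ, E₀) = dim H¹(𝓡_E₀) = [K_v:ℚ_p] + 1` (`finrank_homCont_eq_of_hasCFT` +
   `HasRankOneCohomology`) and Liu's Euler characteristic `-d·n` (no finite-dimensional junk ring).
   A junk datum would therefore need, in Lean, a cardinality/CFT argument on `Hom_cont(Γ_(K_v), E₀ˣ)`
   plus an infinite-dimensional ring with prescribed Herr cohomology — not available.
-/

section Pins

-- (H5 of `AutomorphicRepsGL`): the place subtypes indexing `mixedSpace K` are `Fintype` classically.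
open scoped Classical

variable {n : ℕ} {K : Type} [Field K] [NumberField K] {hcpt : isCompact_glFiniteIntegralLevel n K}

/-- PIN 1a. A cuspidal automorphic representation datum makes the space of cusp forms non-zero. -/
theorem cuspFormsGL_ne_bot_of_cuspidalAutomorphicRepData (π : CuspidalAutomorphicRepData n K hcpt) :
    cuspFormsGL n K hcpt ≠ ⊥ := by
  intro h
  have hlt : π.1.W' < π.1.W := π.1.lt
  have hle : π.1.W ≤ cuspFormsGL n K hcpt := π.2
  have hW : π.1.W = ⊥ := le_bot_iff.1 (hle.trans (le_of_eq h))
  rw [hW] at hlt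
  exact not_lt_bot hlt

/-- PIN 1b. **An inhabitant of `CuspidalAutomorphicRepData n K hcpt` is a non-zero cusp form on
`GL_n(𝔸_K)`** — the object a Lean proof of `¬ NonSplitSteinbergPieces` would have to construct. -/
theorem exists_cuspForm_of_cuspidalAutomorphicRepData (π : CuspidalAutomorphicRepData n K hcpt) :
    ∃ φ : (AdelicGroupData.gl n K).Adelic → ℂ, φ ≠ 0 ∧ IsCuspFormGL n K hcpt φ := by
  by_contra hne
  push Not at hne
  apply cuspFormsGL_ne_bot_of_cuspidalAutomorphicRepData π
  rw [cuspFormsGL, Submodule.span_eq_bot]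
  intro φ hφ
  by_contra h0
  exact hne φ h0 hφ

end Pins

section Shadow

variable {p : ℕ} [Fact p.Prime] {F : Type u} [Field F] [TopologicalSpace F]
  {E : Type v} [Field E] [TopologicalSpace E] [IsTopologicalRing E]

/-- The character of `Fˣ` that a `(φ,Γ)`-datum attaches to a rank-one Galois representation `η`
(`Drig η ≅ 𝓡(δ)`; in the genuine theory `δ = η ∘ Art_F`). -/
def artinShadow (𝔇 : PhiGammaModuleData.{u, v, w} p F E) (η : FramedGaloisRep F E 1) : Fˣ →ₜ* Eˣ :=
  Classical.choose (𝔇.Drig_rank_one η)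

lemma artinShadow_spec (𝔇 : PhiGammaModuleData.{u, v, w} p F E) (η : FramedGaloisRep F E 1) :
    (𝔇.Drig η).IsIso (𝔇.charMod (artinShadow 𝔇 η)) :=
  Classical.choose_spec (𝔇.Drig_rank_one η)

omit [TopologicalSpace F] [TopologicalSpace E] [IsTopologicalRing E] in
/-- `GL_1(E)` is commutative. -/
lemma gl_one_comm (a b : GL (Fin 1) E) : a * b = b * a := by
  refine Matrix.GeneralLinearGroup.ext fun i j => ?_
  fin_cases i; fin_cases j
  simp [Matrix.mul_apply, mul_comm]

omit [TopologicalSpace F] in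
/-- Conjugation is trivial in rank one. -/
lemma conj_eq_self_rank_one (g : GL (Fin 1) E) (η : FramedGaloisRep F E 1) : FramedRep.conj g η = η := by
  ext σ : 1
  rw [FramedRep.conj_apply, gl_one_comm g (η σ), mul_assoc, mul_inv_cancel, mul_one]

/-- PIN 2a. **The Artin shadow is injective**: any `PhiGammaModuleData` embeds the continuous characters
of `Γ_F` (rank-one framed representations) into the continuous characters of `Fˣ`. -/
theorem artinShadow_injective (𝔇 : PhiGammaModuleData.{u, v, w} p F E) :
    Function.Injective (artinShadow 𝔇) := by
  intro η η' h
  have h1 := artinShadow_spec 𝔇 η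
  have h2 := artinShadow_spec 𝔇 η'
  rw [← h] at h2
  obtain ⟨g, hg⟩ := 𝔇.Drig_injective η η' (h1.trans h2.symm)
  rw [hg, conj_eq_self_rank_one]

/-- PIN 2b. The Artin shadow fixes the trivial character. -/
theorem artinShadow_one (𝔇 : PhiGammaModuleData.{u, v, w} p F E) : artinShadow 𝔇 1 = 1 :=
  𝔇.charMod_injective _ _
    (((artinShadow_spec 𝔇 1).symm.trans (𝔇.Drig_one 1)).trans 𝔇.charMod_one.symm)

/-- PIN 2c. Under `HasCFTIdentification`, `dim_E Hom_cont(Fˣ, E) = dim_E H¹_{φ,γ_F}(𝓡_E)`; with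
`HasRankOneCohomology d` the right-hand side is `d + 1` for the unit object (its `H⁰` is a line), so a
KPX datum pins the number of independent continuous additive characters of `Fˣ`. -/
theorem finrank_homCont_eq_of_hasCFT (𝓣 : PhiGammaModuleRobba.{u, v, w} p F E)
    (h : 𝓣.HasCFTIdentification) :
    Module.finrank E (HomCont F E) = Module.finrank E (𝓣.H1 (PhiGammaModule.unit 𝓣.ring)) :=
  LinearEquiv.finrank_eq (LinearEquiv.ofBijective 𝓣.homToH1 h)

end Shadow

/-! ## §5 NEAR-MISS: the negation itself -/

section NearMiss

open Summit.Langlands.Langlands.Theses.SteinbergWeightVelocity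

/-- **NEAR-MISS (the only `sorry` of this file).**  `¬ NonSplitSteinbergPieces` — the theorem the gate
would accept as `Summits/Langlands/Langlands/Theorems/SteinbergWeightVelocityNonSplitSteinbergPiecesRefutation.lean`.
OBSTRUCTION (structural, not mathematical): the witness must inhabit `CuspidalAutomorphicRepData n K hcpt`
with `n ≥ 2` (§4 PIN 1: a non-zero cusp form on `GL_n(𝔸_K)`) and supply a KPX family (§4 PIN 2); neither
is constructible in Mathlib + tree, and no named fact (`Prop`) may be assumed inside a bare `¬S`.
WHAT IS PROVED INSTEAD: §2–§3 — `S` implies non-splitness for `D_rig` of EVERY `ρB ∉ [1]`, contradicted in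
the genuine theory by `ρB = χ_cyc ⊕ 1`; i.e. `S ∧ [X inhabited] ∧ [genuine KPX datum] → False`.
TRIED: junk `π` (constant function: fails the cusp condition — fundamental domains of `K ⊂ 𝔸_K` have
positive measure; one-dimensional stable `W`: needs a genuine cusp form anyway); junk KPX datum (huge
transcendental `(φ = id, Γ trivial)`-ring encoding classes of `ρ` in scalar `matPhi`: meets
`Drig_matGamma_eq_one`/`Drig_injective`/`Drig_conj`/`Drig_one`, but `Drig_rank_one` + `charMod_injective`
need the Artin-shadow injection `Hom_cont(Γ_F,Eˣ) ↪ Hom_cont(Fˣ,Eˣ)` (cardinality `𝔠 ≤ 𝔠`, not provable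
without the structure of `Γ_(K_v)^ab`), and `IsKPX` then needs prescribed infinite Herr cohomology). -/
theorem steinbergWeightVelocityNonSplitSteinbergPieces_refuted_nearMiss : ¬ NonSplitSteinbergPieces := by
  sorry

end NearMiss

/-! ## §6 REPAIR MENU and REGIMES (for the planner / provers)

CLASS: `refuted-misstated` (on paper).  The counterexample exploits the PACKAGING `∀ 𝔇, (∀ E₀, IsKPX) → …`:
`IsKPX` constrains the ring, the rank-one objects, the cohomology counts and "`Drig` hits the étale
objects", but NOTHING ties `Drig ρ` to `ρ` beyond full faithfulness on isomorphism classes — so `Drig` may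
be precomposed with any class-bijection fixing `[1]` (§1).  The author plainly intends `Drig = D_rig^†`.

REPAIRED STATEMENT C′ (believed open = the intended content; the swap witness MISSES it):
strengthen the datum hypothesis to `IsKPX d ∧ IsBerger`, where `IsBerger 𝓣` (new definition item = the
route's own requests (d1) `DrigArtinian` / (d2) `BergerDst`) demands at least
  (B1) `Drig` extends to an EXACT ⊗-FUNCTOR on continuous `E`-linear `Γ_F`-equivariant maps (not only on
       changes of frame): sub-representations go to saturated `(φ,Γ)`-stable submodules, quotients to
       quotients, `Drig (ρ ⊗ ρ') ≅ Drig ρ ⊗ Drig ρ'`;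
  (B2) the rank-one dictionary `Drig η ≅ charMod (η ∘ Art_F)` (needs the local Artin map as data);
  (B3) Berger's comparison: `D_cris/D_st/D_dR` of `Drig ρ` versus `Rec.pst` of `ρ` (turns DstDictionaryAtP
       into a provable statement for the genuine data).
Under (B1) a split graded piece of `D_rig(ρ)` transports back to a splitting of (a subquotient of) `ρ`,
so the relabelled datum `precomp 𝓣 (swapAt rE ρB)` violates (B1)/(B2) and the witness dies.
Lean shape: same binders as `NonSplitSteinbergPieces` with
`(hKPX : ∀ E₀ hE₀, (𝔇 E₀ hE₀).IsKPX d ∧ (𝔇 E₀ hE₀).IsBerger)`; `IsBerger` to be filed under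
`Literature/NumberTheory/GaloisRepresentations/` (definition item).
ALTERNATIVE C″: carry ONE datum `𝔇` at route level (a parameter of every item, fixed before `π, ρ`), with
item-specific hypotheses; then junk data can only make items vacuous, never false.
NOT A REPAIR: `∃ 𝔇`-packaging (junk-provable); for `n ≥ 3` a mere "`Drig` reflects splittings" axiom
(swap with an indecomposable `ρC` having one split interior piece).
SAME DEFECT (planner): 13450 WeightVelocity (clauses (i)–(ii)), 13452 StrictSteinbergTriangulation,
13453 NonCrystallineSteinbergPieces, 13454 ArcJetOrthogonality are false as typed by the same swap;
13449 DstDictionaryAtP and 13463 LocalToMonodromy become vacuously true.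

REGIMES in which the INTENDED statement C′ resists (no cheap kill found; literature 2026-08-15):
* `n = 2`, labelled HT gap ≥ 2: Kedlaya slopes forbid the split saturated line in an étale `D` — C′ true
  (standard; Colmez 2008, KPX §6.3); gap 1 (weight-2 type): C′ = "ρ_(π,v) is not crystalline-split",
  a fragment of ℓ = p local–global compatibility — known for polarisable/ordinary cases, OPEN for
  torsion-built `π` (YangLGC2024 covers weight 0 only).
* `n ≥ 3`, interior pairs: not slope-protected (St₃ table: (1,2) iff b < 2a, (2,3) iff b > 2a); a critical
  companion-type triangulation at an automorphic point would refute C′ — none known; He (arXiv:2401.13242)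
  treats companion points in the Steinberg case under polarisable + Taylor–Wiles hypotheses with monodromy
  ASSUMED.  Caraiani 2014 (polarisable ℓ = p LGC) gives C′ in the self-dual sector.  OPEN otherwise.
* Prover note for C′: in the genuine theory strictness is automatic for all-special flags whose ratios are
  `x^k|x|` with `k ≥ 1` (dévissage + KPX 6.2.8(1)), so `IsStrict` is possibly redundant there.
-/

end Summit.Langlands.Langlands.Cruxes.NonSplitSteinbergPieces.Disproof
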